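import Summits.CriticalPhenomena.PercolationContinuityZ3.Theorems.PercNearOneGluingNoHeavyQuantSliceSmallLayers
import Summits.CriticalPhenomena.PercolationContinuityZ3.Theorems.PercNearOneGluingNoHeavyQuantDECAtTMixtures
import Summits.CriticalPhenomena.PercolationContinuityZ3.Theorems.PercNearOneGluingNoHeavyQuantLawDecFlowsDecomposition
import HarnessLib

/-!
# QUANT lane R8, T-DEC: Conjecture SL is TARGET-FREE — the typed statement `LawDec.SliceClosedT` (explicit common target, no mean,
# no top-affordability), the reduction `SliceClosedT → SliceClosed`, its flow form, and the gate-`1` case as a theorem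

builds on p205010 (kernel theorem, internal audit signed; external expert review pending)

Statement + support file (`--supports stmt-CriticalPhenomena-4575`), QUANT lane seat prim-quant-census-2 (gen 54), rung R8 of
`run/shared/lean/prim/quant/LADDER.md`.  Memo `run/shared/lean/prim/quant/prim-quant-census-2-g54/SL-STRUCTURE-G54.md`.  One
`@[conjecture]`, theorems with standard axioms, no sorries.  Continues `…QuantSliceClosure` (g53: `LawDec.slice`, `LawDec.SliceClosed`),
`…QuantSliceSmallLayers` / `…QuantDECAtTMixtures` / `…QuantLawDecFlowsDecomposition` (typer g22: slice law facts, `sliceClosed_iff_le`,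
`decAtT_shift_two`, `decAtT_iff_flowAtT`).

THE FINDING (census-2 g54, exact LP).  In `LawDec.SliceClosed` (SL) the two DEC hypotheses on `μ` are taken AT THE MEAN of `μ` and the
conclusion at the mean of the slice, and `μ` is assumed top-affordable.  None of this is used: on every instance tested the statement
holds with an ARBITRARY COMMON EXPLICIT TARGET `T` — `DECAtT x T j′ M μ ∧ DECAtT x T (j′−a) M μ ⟹ DECAtT x (T + a·g) j′ (M+a) (slice μ a g)`
— for targets above and below the mean and without top-affordability (local: 4 711 (layer, target) instances incl. `T = mean ± mean/4`,
`± 1`; 1 058 extreme rays of the two-layer DEC cone at random targets; kit job j137385 = the same at scale, attached to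
stmt-CriticalPhenomena-4575; 0 failures).  Consistently, in the per-certificate dual split (LP duality: SL on a cell ⟺ every price system of
the slice is dominated coefficientwise by a layer-`j′` system plus a layer-`(j′−a)` system plus a multiple of the mean identity) the
mean multiplier is never needed (≈ 1 300 certificates incl. near-tight ones, always dominated with multiplier `0`).  So SL is a statement
about three polyhedral cones of laws at fixed `(x, T, j′, a, g)` — `C_T(j′) ∩ C_T(j′−a) ⊆ slice⁻¹ C_{T+ag}(j′)` — and this file types it.

* **`LawDec.SliceClosedT`** (`@[conjecture]`) — SL′: for `0 < x < 1`, `x ≤ g ≤ 1`, `1 ≤ a ≤ j′`, a law `μ ≥ 0` on `{0..M}` of mass `1` and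
  ANY real `T`: `DECAtT x T j′ M μ → DECAtT x T (j′−a) M μ → DECAtT x (T + a·g) j′ (M + a) (slice μ a g)`.  (Layers `j′ < a` need no
  hypothesis — `slice_decAt_of_lt` / criterion E — and are left out, as in `sliceClosed_iff_le`.)
* **`LawDec.sliceClosed_of_sliceClosedT : SliceClosedT → SliceClosed`** — SL is the instance `T = mean μ` (`decAt_iff_decAtT`,
  `sum_mul_slice`, `sliceClosed_iff_le`); the top-affordability hypothesis of SL is simply dropped.
* **`LawDec.sliceClosedT_iff_flow`** — SL′ in the flow normal form (`decAtT_iff_flowAtT` on both sides; slice law facts `sum_slice`,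
  `slice_eq_zero`): the form in which the census and the charging reformulation (memo §3) work.
* **`LawDec.slice_one_eq_shift`**, **`LawDec.sliceClosedT_gate_one`** — the gate-`1` end of SL′ is a THEOREM from the layer-`(j′−a)`
  hypothesis alone: `slice μ a 1` is the shift by `a`, DEC(j′) at target `T + 2a ≥ T + a` (`decAtT_shift_two`, antitone).
The gate-`x` end is the hard end (memo §4: tightest census margins at `g → 1⁻` come from the idle-compensator rays, but the gate-`1`
boundary itself is slack by `a` in the target).

[this work]; DEC rules ARCH-TREES-G49 §2.2 / DEC-TAMP-G50 §3.1, memos DEC-CLOSURE-G53, FOR-PROVERS-SL, SL-STRUCTURE-G54 (this lane).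
The gluing rows served [cite: KozmaNitzan2024, Conjecture 3 (p. 15)]; product measure [cite: Grimmett1999, §1.3 p. 10].
-/

noncomputable section

namespace Summit.CriticalPhenomena.PercolationContinuityZ3.Theorems

namespace Quant

open Finset

namespace LawDec

/-! ### The target-free conjecture -/

/-- **CONJECTURE SL′ (target-free slice closure of DEC).**  For a floor `0 < x < 1`, a gate `x ≤ g ≤ 1`, a blob size `1 ≤ a ≤ j′`,
a law `μ ≥ 0` on `{0..M}` of mass `1` and ANY target `T`: if `μ` is DEC at target `T` at the layers `j′` and `j′ − a`
(`LawDec.DECAtT`), then the one-blob slice `LawDec.slice μ a g` (`h ↦ (1−g)·μ h + g·μ(h−a)·[a ≤ h]`) is DEC at target `T + a·g` at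
layer `j′` on `{0..M+a}`.  `LawDec.SliceClosed` is the case `T = mean μ` (`sliceClosed_of_sliceClosedT`); no top-affordability.
EVIDENCE (exact rationals, 0 failures): census-2 g54 local 4 711 (layer, target) instances with `T` above and below the mean, 1 058 extreme
rays of the two-layer DEC cone, kit j137385 (attached to stmt-CriticalPhenomena-4575); g53's SL censuses (≈ 1.09 M layers at the mean).
KNOWN CASES: data with no light credit pair at layer `j′` (`slice_decAtT_of_hdecAtT`, typer g22 — one hypothesis); gate `g = 1`
(`sliceClosedT_gate_one` — the other hypothesis); layers `j′ < a` (no hypothesis, `slice_decAt_of_lt`).  OPEN: light straddlers.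
builds on p205010 (kernel theorem, internal audit signed; external expert review pending). [this work] [status: open] -/
@[conjecture] def SliceClosedT : Prop :=
  ∀ (x g T : ℝ) (M a j' : ℕ) (μ : ℕ → ℝ),
    0 < x → x < 1 → x ≤ g → g ≤ 1 → 1 ≤ a → a ≤ j' →
    (∀ h, 0 ≤ μ h) → (∀ h, M < h → μ h = 0) → (∑ h ∈ Finset.range (M + 1), μ h = 1) →
    DECAtT x T j' M μ → DECAtT x T (j' - a) M μ →
    DECAtT x (T + (a : ℝ) * g) j' (M + a) (slice μ a g)

/-! ### SL′ ⟹ SL -/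

/-- **SL′ implies SL**: `LawDec.SliceClosed` is `LawDec.SliceClosedT` at `T = mean μ` (the slice has mean `mean μ + a·g`,
`sum_mul_slice`); the top-affordability hypothesis of SL is not used, and layers `j′ < a` are `slice_decAt_of_lt`
(`sliceClosed_iff_le`). [this work] -/
theorem sliceClosed_of_sliceClosedT (hT : SliceClosedT) : SliceClosed := by
  rw [sliceClosed_iff_le]
  intro x g M a j' μ hx0 hxg hg1 ha hμ0 hμM hμ1 _htop haj _hjM hd hd'
  have hx1 : x < 1 := lt_of_le_of_lt hxg hg1
  rw [decAt_iff_decAtT] at hd hd' ⊢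
  rw [sum_mul_slice μ a g M hμM hμ1]
  exact hT x g _ M a j' μ hx0 hx1 hxg hg1.le ha haj hμ0 hμM hμ1 hd hd'

/-! ### The flow form -/

/-- **SL′ in the flow normal form** (`LawDec.FlowAtT` = the census's dec LP): equivalent to `SliceClosedT` by `decAtT_iff_flowAtT`
(law facts of the slice: `slice_eq_zero`, `sum_slice`). [this work] -/
theorem sliceClosedT_iff_flow :
    SliceClosedT ↔
      ∀ (x g T : ℝ) (M a j' : ℕ) (μ : ℕ → ℝ),
        0 < x → x < 1 → x ≤ g → g ≤ 1 → 1 ≤ a → a ≤ j' →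
        (∀ h, 0 ≤ μ h) → (∀ h, M < h → μ h = 0) → (∑ h ∈ Finset.range (M + 1), μ h = 1) →
        FlowAtT x T j' M μ → FlowAtT x T (j' - a) M μ →
        FlowAtT x (T + (a : ℝ) * g) j' (M + a) (slice μ a g) := by
  constructor
  · intro hT x g T M a j' μ hx0 hx1 hxg hg1 ha haj hμ0 hμM hμ1 hf hf'
    have hsM : ∀ h, M + a < h → slice μ a g h = 0 := fun h hh => slice_eq_zero μ a g M hμM h hh
    have hs1 := sum_slice μ a g M hμM hμ1
    rw [← decAtT_iff_flowAtT x _ j' (M + a) _ hx0 hx1 hsM hs1]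
    rw [← decAtT_iff_flowAtT x T j' M μ hx0 hx1 hμM hμ1] at hf
    rw [← decAtT_iff_flowAtT x T (j' - a) M μ hx0 hx1 hμM hμ1] at hf'
    exact hT x g T M a j' μ hx0 hx1 hxg hg1 ha haj hμ0 hμM hμ1 hf hf'
  · intro hF x g T M a j' μ hx0 hx1 hxg hg1 ha haj hμ0 hμM hμ1 hd hd'
    have hsM : ∀ h, M + a < h → slice μ a g h = 0 := fun h hh => slice_eq_zero μ a g M hμM h hh
    have hs1 := sum_slice μ a g M hμM hμ1
    rw [decAtT_iff_flowAtT x _ j' (M + a) _ hx0 hx1 hsM hs1]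
    rw [decAtT_iff_flowAtT x T j' M μ hx0 hx1 hμM hμ1] at hd
    rw [decAtT_iff_flowAtT x T (j' - a) M μ hx0 hx1 hμM hμ1] at hd'
    exact hF x g T M a j' μ hx0 hx1 hxg hg1 ha haj hμ0 hμM hμ1 hd hd'

/-! ### The gate-`1` end is a theorem -/

/-- at gate `1` the slice is the shift by `a`. [this work] -/
theorem slice_one_eq_shift (μ : ℕ → ℝ) (a : ℕ) :
    slice μ a 1 = fun h => if a ≤ h then μ (h - a) else 0 := by
  funext h
  simp only [slice, sub_self, zero_mul, zero_add, one_mul]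

/-- **SL′ AT GATE `g = 1` holds from the layer-`(j′−a)` hypothesis alone**: the slice is `μ` shifted by `a`, which is DEC(j′) at
target `T + 2a` (`decAtT_shift_two`: sure mass counts double), hence at `T + a·1 ≤ T + 2a` (`decAtT_antitone_target`). [this work] -/
theorem sliceClosedT_gate_one (x T : ℝ) (M a j' : ℕ) (μ : ℕ → ℝ) (haj : a ≤ j')
    (hd' : DECAtT x T (j' - a) M μ) :
    DECAtT x (T + (a : ℝ) * 1) j' (M + a) (slice μ a 1) := by
  rw [slice_one_eq_shift, mul_one]
  have h := decAtT_shift_two x T (j' - a) M a μ hd'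
  rw [Nat.sub_add_cancel haj] at h
  exact decAtT_antitone_target (by linarith [(Nat.cast_nonneg a : (0 : ℝ) ≤ a)]) h

end LawDec

end Quant

end Summit.CriticalPhenomena.PercolationContinuityZ3.Theorems
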